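import Literature.NumberTheory.PAdicHodge.AinfWeierstrassDivisionLift
import Literature.NumberTheory.PAdicHodge.CompletedAlgClosureAlgClosed
import HarnessLib

/-!
# `(p, ξ)𝔸_inf = θ⁻¹(p 𝒪_{ℂ_F})`: the arguments of the `p`-adic formal logarithms, in terms of `θ`

Topic `Literature/NumberTheory/PAdicHodge`; namespace `Literature.NumberTheory.PAdicHodge.GaloisContinuity`. THEOREMS ONLY (no definition, no instance, no
named fact, no `sorry`). The domain of this seat's `p`-adic evaluation layer (`IsLogModFil`, `IsLogTypeModFil`, `IsFormalLogModFil`: arguments in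
`(p, ξ)𝔸_inf`) described by `θ`:

* ★ `mem_span_p_xi_iff_norm_fontaineTheta_le` — `a ∈ (p, ξ)𝔸_inf ↔ ‖θ(a)‖ ≤ ‖p‖` (`(p, ξ) = θ⁻¹(p𝒪_{ℂ_F})`; `θ` onto `𝒪_{ℂ_F}`, tree
  `surjective_fontaineTheta_integerC` / `PreTilt.untilt_surjective`);
* ★ `torsionLift_mem_span_p_xi_iff` — Fontaine's integral `[ũ]` of a `[p]`-division sequence `u` of points of `Ŵ(𝔪_{ℂ_F})` (K1, `AinfTop.divisionLiftPt`)
  has its coordinate in `(p, ξ)` iff `‖u₀‖ ≤ ‖p‖`, i.e. iff the base point lies in `Ŵ(p𝒪_{ℂ_F})` — the hypothesis of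
  `IsFormalLogModFil.galBdRPlus_sub_sub_omegaPeriod_mem` (`BdRPlusFormalLogKummer`).

Floor (H4) step (3) of `Summits/…/Cruxes/StarredOptimalManinUnitFiveSeven/Lines/kato-lever-K3-B2-road.md` (crux K★ `stmt-BirchSwinnertonDyer-22226`).
Infrastructure only; BSD / K★ are not proved by any of this.

## References
* J.-M. Fontaine, *Le corps des périodes p-adiques*, Astérisque 223 (1994), Exp. II §1.2.2–1.2.3. [FontaineAsterisque223III]
-/

noncomputable section

namespace Literature.NumberTheory.PAdicHodge

namespace GaloisContinuity

open ValuativeRel Field Ideal WittVector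
open Literature.NumberTheory.GaloisRepresentations Literature.NumberTheory.GaloisRepresentations.IsNonarchimedeanLocalField
open Literature.NumberTheory.GaloisRepresentations.LubinTate

variable {F : Type} [Field F] [ValuativeRel F] [TopologicalSpace F] [IsNonarchimedeanLocalField F]
  [CharZero F] {p : ℕ} [Fact p.Prime] [Fact (¬ IsUnit (p : integerC F))]
  [IsAdicComplete (Ideal.span {(p : integerC F)}) (integerC F)]

/-- ★ **`(p, ξ)𝔸_inf = θ⁻¹(p 𝒪_{ℂ_F})`**: `a ∈ (p, ξ) ↔ ‖θ(a)‖ ≤ ‖p‖` (`θ` is onto `𝒪_{ℂ_F}` and `ker θ = (ξ)`).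
[cite: FontaineAsterisque223III, Exp. II §1.2.2–1.2.3] -/
theorem mem_span_p_xi_iff_norm_fontaineTheta_le (hF : Function.Surjective (fontaineTheta (integerC F) p)) (a : Ainf (p := p) F) :
    a ∈ Ideal.span {(p : Ainf (p := p) F), xi} ↔
      ‖((fontaineTheta (integerC F) p a : integerC F) : CompletedAlgClosure F)‖ ≤ ‖(p : CompletedAlgClosure F)‖ := by
  constructor
  · intro h
    obtain ⟨x, y, rfl⟩ := Ideal.mem_span_pair.1 h
    rw [map_add, map_mul, map_mul, fontaineTheta_xi, mul_zero, add_zero, map_natCast]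
    push_cast
    rw [norm_mul]
    exact mul_le_of_le_one_left (norm_nonneg _) (norm_coe_integerC_le _)
  · intro h
    haveI : CharZero (CompletedAlgClosure F) := charZero_of_injective_algebraMap (algebraMap F (CompletedAlgClosure F)).injective
    have hp0 : (p : CompletedAlgClosure F) ≠ 0 := Nat.cast_ne_zero.2 (Fact.out : p.Prime).ne_zero
    -- `θ(a) = p · c` with `c ∈ 𝒪_{ℂ_F}`, `c = θ(b)`
    have hc : ‖((fontaineTheta (integerC F) p a : integerC F) : CompletedAlgClosure F) / (p : CompletedAlgClosure F)‖ ≤ 1 := by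
      rw [norm_div, div_le_one (norm_pos_iff.2 hp0)]; exact h
    obtain ⟨b, hb⟩ := hF ⟨_, (mem_integerC_iff (F := F)).2 hc⟩
    have hθ : fontaineTheta (integerC F) p (a - (p : Ainf (p := p) F) * b) = 0 := by
      refine Subtype.ext ?_
      rw [map_sub, map_mul, map_natCast, hb]
      push_cast
      rw [mul_div_cancel₀ _ hp0, sub_self]
    have hker : a - (p : Ainf (p := p) F) * b ∈ Ideal.span {(xi : Ainf (p := p) F)} := by
      rw [← ker_fontaineTheta_eq_span_xi]; exact hθ
    obtain ⟨y, hy⟩ := Ideal.mem_span_singleton'.1 hker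
    exact Ideal.mem_span_pair.2 ⟨b, y, by rw [hy]; ring⟩

variable {hθ : Function.Surjective (fontaineTheta (integerC F) p)}

/-- ★ **Fontaine's integral `[ũ]` has its coordinate in `(p, ξ)` iff `‖u₀‖ ≤ ‖p‖`** (`θ([ũ]) = u₀`, K1 `thetaPt_divisionLiftPt`): the base point of the
division sequence lies in `Ŵ(p𝒪_{ℂ_F})`. [cite: FontaineAsterisque223III, Exp. II §1.2.2] -/
theorem torsionLift_mem_span_p_xi_iff (W : WeierstrassCurve ℤ) (u : ℕ → (maxNilIdealC F).toIdeal)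
    (hup : ∀ n, AinfTop.mulPC F p W (u (n + 1)) = u n) :
    (AinfTop.of F p).symm (AinfTop.torsionLift W hθ u hup) ∈ Ideal.span {(p : Ainf (p := p) F), xi} ↔
      ‖(((u 0 : (maxNilIdealC F).toIdeal) : CBall F) : CompletedAlgClosure F)‖ ≤ ‖(p : CompletedAlgClosure F)‖ := by
  have hθu : ((AinfTop.theta F p (AinfTop.torsionLift W hθ u hup) : CBall F) : CompletedAlgClosure F) =
      (((u 0 : (maxNilIdealC F).toIdeal) : CBall F) : CompletedAlgClosure F) := by
    have h2 := AinfTop.thetaPt_divisionLiftPt W (hθ := hθ) u hup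
    have h3 := congrArg (fun P : W.Pt (maxNilIdealC F) => ((P.val : CBall F) : CompletedAlgClosure F)) h2
    simpa only [AinfTop.coe_val_thetaPt, AinfTop.coe_val_divisionLiftPt] using h3
  rw [mem_span_p_xi_iff_norm_fontaineTheta_le hθ, ← AinfTop.coe_theta, RingEquiv.apply_symm_apply, hθu]

end GaloisContinuity

end Literature.NumberTheory.PAdicHodge

end
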